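import Summits.Ventures.CertifiedManyBodySolver.Downfold.BoxesLa214
import HarnessLib

/-!
# Bisection of one coordinate of a typed parameter box: the two halves COVER the box, each half REFINES
# it, and a word certified on both halves is a word on the box (the door for U-SLICED sub-boxes)

Venture CertifiedManyBodySolver, cell `pub/hubbard-downfold` (stage S1 = ROUTER), seat hubbard-downfold-mod-4 (S1/S2 Emery seam);
namespace `Summit.Ventures.CertifiedManyBodySolver.Downfold`. Generic over the coordinate type `ι` of `Downfold.Box`
(`ParameterBox`: `Box ι = ι → Option Entry`, `Box.Mem`, `Box.Refines`, `HoldsOn`; `BoxesLa214`: `Entry.ofEnds`).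

WHY (cell file router/INFLATION-RULES-3to1-B.md §B.23, ruling R-B16(b) asked): under reading fl the bare-electron level of a
Kohn–Sham three-band member is `Δ^e = Δ − (U_dd n̄_d − U_pp n̄_p)/2`, so on a PRODUCT box its entry inherits the full width of the
`U` rows (La₂CuO₄: 5 eV) although the consistent object is the sheared set `{(U, Δ^e(U))}`. Slicing the `U_dd` (and `U_pp`) entry
into sub-intervals and giving each slice its own `Δ^e` entry recovers the correlation with product boxes only — which is all the
seam's doors (`S2SeamEmery`, `EmeryMonotoneVertexFloors`, `EmeryReadingSeam.flImage_mem_update`) accept. This file is the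
one generic fact that makes a finite family of slices as good as the box:

* `Box.mem_update_split` — replacing the entry `e` of coordinate `c` by `[e.lo, m]` resp. `[m, e.hi]` (`Entry.ofEnds`, any
  grades) gives two boxes whose union CONTAINS the original box (every member lies in one of them);
* `Box.holdsOn_of_split` — THE DOOR: a word on both halves is a word on the box; iterate for 2ᵏ slices
  (`Function.update_idem` collapses nested updates of the same coordinate — `Box.update_update_same`);
* `Box.update_sub_refines` — a box with coordinate `c` narrowed to ANY `[a, b] ⊆ [e.lo, e.hi]` refines the original (words on the
  box transfer DOWN to every slice: `Box.holdsOn_update_sub`);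
* `Box.mem_update_of_mem_of_bounds` — pointwise form: a member whose `c`-coordinate lies in `[a, b]` is a member of the narrowed box.

Everything here is PROVED (0 sorry); pure bookkeeping on `Function.update`; no physics.
-/

namespace Summit.Ventures.CertifiedManyBodySolver.Downfold

open NonemptyInterval

variable {ι : Type*} [DecidableEq ι]

/-- **Pointwise narrowing**: if `p ∈ E`, `E c = some e` and `a ≤ p c ≤ b` then `p` is a member of `E` with the `c` entry replaced by
`[a, b]`. [folklore] -/
theorem Box.mem_update_of_mem_of_bounds {E : Box ι} {c : ι} {a b : ℚ} (hab : a ≤ b) (g : Grade)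
    {p : ι → ℝ} (hp : E.Mem p) (ha : ((a : ℚ) : ℝ) ≤ p c) (hb : p c ≤ ((b : ℚ) : ℝ)) :
    Box.Mem (Function.update E c (some (Entry.ofEnds a b hab g))) p := by
  intro i f hi
  by_cases hic : i = c
  · subst hic
    rw [Function.update_self, Option.some.injEq] at hi
    subst hi
    exact (Entry.mem_ofEnds_iff _ _ _ _ _).2 ⟨ha, hb⟩
  · rw [Function.update_of_ne hic] at hi
    exact hp i f hi

/-- **BISECTION COVERS THE BOX**: with `E c = some e` and a cut point `e.lo ≤ m ≤ e.hi`, every member of `E` is a member of the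
lower half `[e.lo, m]` or of the upper half `[m, e.hi]` (grades arbitrary). [folklore] -/
theorem Box.mem_update_split {E : Box ι} {c : ι} {e : Entry} (hc : E c = some e) {m : ℚ}
    (hlo : e.encl.fst ≤ m) (hhi : m ≤ e.encl.snd) (g₁ g₂ : Grade) {p : ι → ℝ} (hp : E.Mem p) :
    Box.Mem (Function.update E c (some (Entry.ofEnds e.encl.fst m hlo g₁))) p ∨
      Box.Mem (Function.update E c (some (Entry.ofEnds m e.encl.snd hhi g₂))) p := by
  have hx := mem_ratCast_iff.1 (hp c e hc)
  rcases le_total (p c) ((m : ℚ) : ℝ) with hle | hge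
  · exact Or.inl (Box.mem_update_of_mem_of_bounds hlo g₁ hp hx.1 hle)
  · exact Or.inr (Box.mem_update_of_mem_of_bounds hhi g₂ hp hge hx.2)

/-- **THE DOOR — a word on both halves is a word on the box.** [folklore] -/
theorem Box.holdsOn_of_split {E : Box ι} {c : ι} {e : Entry} (hc : E c = some e) {m : ℚ}
    (hlo : e.encl.fst ≤ m) (hhi : m ≤ e.encl.snd) (g₁ g₂ : Grade) {W : (ι → ℝ) → Prop}
    (h₁ : HoldsOn W (Function.update E c (some (Entry.ofEnds e.encl.fst m hlo g₁))))
    (h₂ : HoldsOn W (Function.update E c (some (Entry.ofEnds m e.encl.snd hhi g₂)))) : HoldsOn W E :=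
  fun p hp => (Box.mem_update_split hc hlo hhi g₁ g₂ hp).elim (h₁ p) (h₂ p)

/-- **A narrowed box refines the original**: if `E c = some e` and `[a, b] ⊆ [e.lo, e.hi]` then the box with the `c` entry
replaced by `[a, b]` refines `E`. [folklore] -/
theorem Box.update_sub_refines {E : Box ι} {c : ι} {e : Entry} (hc : E c = some e) {a b : ℚ} (hab : a ≤ b)
    (ha : e.encl.fst ≤ a) (hb : b ≤ e.encl.snd) (g : Grade) :
    Box.Refines (Function.update E c (some (Entry.ofEnds a b hab g))) E := by
  intro p hp i f hi
  by_cases hic : i = c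
  · subst hic
    rw [hc, Option.some.injEq] at hi
    subst hi
    have h := (Entry.mem_ofEnds_iff a b hab g (p i)).1 (hp i _ (by rw [Function.update_self]))
    rw [Entry.Mem, mem_ratCast_iff]
    exact ⟨le_trans (by exact_mod_cast ha) h.1, le_trans h.2 (by exact_mod_cast hb)⟩
  · exact hp i f (by rw [Function.update_of_ne hic]; exact hi)

/-- **Words transfer DOWN to every slice.** [folklore] -/
theorem Box.holdsOn_update_sub {E : Box ι} {c : ι} {e : Entry} (hc : E c = some e) {a b : ℚ} (hab : a ≤ b)
    (ha : e.encl.fst ≤ a) (hb : b ≤ e.encl.snd) (g : Grade) {W : (ι → ℝ) → Prop} (hW : HoldsOn W E) :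
    HoldsOn W (Function.update E c (some (Entry.ofEnds a b hab g))) :=
  hW.of_refines (Box.update_sub_refines hc hab ha hb g)

/-- Nested updates of the same coordinate collapse (so bisecting a half is again a single update of the original box).
[folklore] -/
theorem Box.update_update_same (E : Box ι) (c : ι) (e₁ e₂ : Option Entry) :
    Function.update (Function.update E c e₁) c e₂ = Function.update E c e₂ :=
  Function.update_idem _ _ _

/-- The updated coordinate of a slice reads back its entry (the `hc` hypothesis for the next bisection). [folklore] -/
theorem Box.update_apply_same (E : Box ι) (c : ι) (e : Entry) : Function.update E c (some e) c = some e :=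
  Function.update_self _ _ _

/-- **Quartering** (two bisections): with cut points `e.lo ≤ m₁ ≤ m₂ ≤ m₃... ` — stated for three cuts `m₁ ≤ m₂ ≤ m₃` inside
`[e.lo, e.hi]`: words on the four slices `[lo, m₁], [m₁, m₂], [m₂, m₃], [m₃, hi]` give the word on the box. [folklore] -/
theorem Box.holdsOn_of_quarter {E : Box ι} {c : ι} {e : Entry} (hc : E c = some e) {m₁ m₂ m₃ : ℚ}
    (h01 : e.encl.fst ≤ m₁) (h12 : m₁ ≤ m₂) (h23 : m₂ ≤ m₃) (h34 : m₃ ≤ e.encl.snd) (g : Grade)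
    {W : (ι → ℝ) → Prop}
    (w₁ : HoldsOn W (Function.update E c (some (Entry.ofEnds e.encl.fst m₁ h01 g))))
    (w₂ : HoldsOn W (Function.update E c (some (Entry.ofEnds m₁ m₂ h12 g))))
    (w₃ : HoldsOn W (Function.update E c (some (Entry.ofEnds m₂ m₃ h23 g))))
    (w₄ : HoldsOn W (Function.update E c (some (Entry.ofEnds m₃ e.encl.snd h34 g)))) : HoldsOn W E := by
  intro p hp
  have hx := mem_ratCast_iff.1 (hp c e hc)
  rcases le_total (p c) ((m₂ : ℚ) : ℝ) with hle2 | hge2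
  · rcases le_total (p c) ((m₁ : ℚ) : ℝ) with hle1 | hge1
    · exact w₁ p (Box.mem_update_of_mem_of_bounds h01 g hp hx.1 hle1)
    · exact w₂ p (Box.mem_update_of_mem_of_bounds h12 g hp hge1 hle2)
  · rcases le_total (p c) ((m₃ : ℚ) : ℝ) with hle3 | hge3
    · exact w₃ p (Box.mem_update_of_mem_of_bounds h23 g hp hge2 hle3)
    · exact w₄ p (Box.mem_update_of_mem_of_bounds h34 g hp hge3 hx.2)

end Summit.Ventures.CertifiedManyBodySolver.Downfold
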